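import Summits.Ventures.GridStability.Bench.WSCC9SP9SlabRate
import Literature.MathematicalPhysics.PowerSystems.LuriePostnikovSlabPositivity
import Literature.Computation.Certificates.PosSemidefDecide
import HarnessLib

/-!
# «#45-LEVEL+ (LP)» — ★ #45's slab certificate re-read through Lur'e–Postnikov POSITIVITY: the SAME
# exact object certifies a 220× LARGER LEVEL (`c = 8085/65536` instead of `cQ = 366951/655360000`)
# and a 14.8× larger Euclidean inner ball (`√ϱ ≈ 0.1756` instead of `≈ 0.0118`) — no solver, one file

Cell `gridfusion` (LADDER-GRIDFUSION G2.b SP lane); seat gridfusion-lit-6 (g8); the first INSTANCE of lit-6's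
`Literature/MathematicalPhysics/PowerSystems/LuriePostnikovSlabPositivity.lean` (`LPSlabCertificate`,
`SlabCertificate.toLP`): the Lur'e–Postnikov function `V = xᵀPx + 2Σ λ_e ∫₀^{y_e} F_e` of ★ #45's certificate
`WSCC9SP9Slab.cert` (Bench/WSCC9SP9SlabRoa.lean, data Lyapunov/WSCC9SP9SlabData.lean: `Pq`, `λ_e ≤ 1`,
`a_e = 7/10`, `ε = 39/8192`) is minorised on the closed slab not only by `xᵀPx` (the class of record) but
by `xᵀ(P + Cᵀ·diag(λ_e a_e)·C)x` (`LPSlabCertificate.le_V_of_slab`: each Popov integral is at least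
`(a_e/2)·y_e²`, Khalil §7.1 loop transformation). Rank-one level facts against this LOWER MATRIX
`L = P + Cᵀ·diag(λa)·C` — `s_e·L − C_eᵀC_e ⪰ 0` with the dyadic `s_e` below (eight 11 × 11 `LDLᵀ`, decided
in the kernel from ★ #45's tree literals BY NAME; no producer object) — put every level `c` with
`c·s_e ≤ γ_lo²` below `V` on the slab's faces (`LPSlabCertificate.lt_V_of_mem_frontier_slab` via `cert.toLP`),
hence ★ #45's sentence (`WSCC9SP9Slab.sp9_slab_roa`, via model-2's `Params.tendsto_relState_of_slabCertificate`
which takes the face hypothesis `hfr` as an input) holds VERBATIM with the level `cLQ = 8085/65536 ≈ 0.1234`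
in place of the ε-route level `cQ = 366951/655360000 ≈ 0.00056` (ratio 220.3; the best level the OLD class's
rank-one route `s_e·P − C_eᵀC_e ⪰ 0` could give on this object is ≈ 0.0150, ratio 8.2 below `cLQ`).
With #94's upper fact `p₂·1 − (P + Cᵀ·diag(λ)·C) ⪰ 0`, `p₂ = 4099/1024` (`WSCC9SP9SlabRate.upper_posSemidef`,
BY NAME) the certified Euclidean inner ball of the enlarged well has `ϱ = cLQ/p₂ = 8085/262336 ≈ 0.0308`
(`√ϱ ≈ 0.1756`; the «#45-BALL» radius² at the ε-level is `cQ/p₂ ≈ 0.00014`, `√ ≈ 0.0118`).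

WHAT IS DECIDED / PROVED HERE: `LQ` (the lower matrix over `ℚ` on the state type `Fin 8 ⊕ Fin 3`), `sLQ`,
`cLQ`, `rhoLQ`; `rk_ldl` (the eight rank-one `LDLᵀ` facts, kernel), `level_tests`, `ball_tests` (closed
rational inequalities, kernel); `lowerMatrix_eq` (cast plumbing: `cert.toLP.lowerMatrix = LQ ↦ ℝ`),
`lower_rankOne` (the eight PSD facts over `ℝ`), `hfrLP` (the face hypothesis at level `cLQ`),
`sp9_slab_roa_levelLP` (★ #45's sentence at level `cLQ`), `ball_subset_well_LP`
(`{x : xᵀx ≤ ϱ} ⊆ {x ∈ slab(97/200) : V x ≤ cLQ}`) and `sp9_slab_roa_of_ball_LP` (★ #45's conclusions from the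
single hypothesis `‖relState y‖² ≤ ϱ`).

THREE COLUMNS. CERTIFIED (kernel): for MODEL M′_D = `(WSCC9SP.params D).phaseField` (★ #45's declared-damping
structure-preserving WSCC variant — CANARY, NOT OF RECORD, exactly as ★ #45) and CLASS = slab `u = 1/4`,
`γ_lo = 97/200`, level `cLQ = 8085/65536` of the SAME `V`: the region sentence of ★ #45 with the larger
level, and the inner ball `ϱ = 8085/262336`; inner estimates (sufficient, not sharp); nothing new is
claimed about the certificate's data, only a sharper reading of the same exact object through a proved
class theorem. VALIDATED: the float comparison «old best rank-one level ≈ 0.0150» (lit-6 seat arithmetic,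
exact rationals, not a kernel statement) and any simulated region. MODELLED: as ★ #45 verbatim («MV-3 +
lossless + MV-RD(0.046 @ slack G1) + D⟨declared⟩ + V-frozen(V1) + ω_R printed + ref bus 9; canary NOT of
record»). No sentence of this file says the WSCC system or any grid is stable.
[cite: Khalil2002, §7.1.2 Theorem 7.3 with the loop transformation of §7.1 (Example 7.5); Pai1981, §2.16 Theorem [18] eqs. (2.63)–(2.64) and §4.6 eqs. (4.45)–(4.46); VuTuritsyn2017, §4.3 Theorem 1 with eq. (V_min)]
-/

noncomputable section

open Set Filter Topology Real Matrix
open Literature.MathematicalPhysics.PowerSystems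
open Literature.MathematicalPhysics.PowerSystems.LyapunovFunctionFamily
open Literature.Computation.Certificates
open Summit.Ventures.GridStability.Models
open Summit.Ventures.GridStability.Models.StructurePreserving
open Summit.Ventures.GridStability.Models.WSCC9SP
open Summit.Ventures.GridStability.Lyapunov.WSCC9SP9Slab (Pq lamQ aQ epsQ etaQ cQ)
open Summit.Ventures.GridStability.Lyapunov.WSCC9SP9SlabRate (p2Q p2Q_facts)
open Summit.Ventures.GridStability.Bench.WSCC9SP9Slab (D hD e1 CQ C_eq PQ P cert a_le_slabSlope one_le_b)
open Summit.Ventures.GridStability.Bench.WSCC9SP9SlabRate (hsec upper_posSemidef)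

namespace Summit.Ventures.GridStability.Bench.WSCC9SP9SlabLP

/-! ### The new literals (all dyadic; lit-6 seat arithmetic, re-decided below) -/

/-- Per-line rank-one constants against the LOWER matrix: dyadic upper bounds (margin ≈ 0.4 %) of
`C_e (P + Cᵀ·diag(λa)·C)⁻¹ C_eᵀ`. -/
def sLQ : Fin 8 → ℚ := ![7809/4096, 413/512, 3781/4096, 4297/4096, 1543/2048, 3739/4096, 7/8, 2033/2048]

/-- The enlarged level `cLQ = 8085/65536 ≈ 0.12337` (largest dyadic `2⁻¹⁶`-multiple with `c·s_e ≤ γ_lo²`). -/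
def cLQ : ℚ := 8085/65536

/-- The inner ball's radius² `ϱ = cLQ/p₂ = 8085/262336 ≈ 0.03082` (`p₂ = 4099/1024` of #94). -/
def rhoLQ : ℚ := 8085/262336

/-- **The LOWER comparison matrix over `ℚ`** on the state type: `L = P + Cᵀ·diag(λ_e a_e)·C`
(`a_e = 7/10` on every line). -/
def LQ : Matrix (Fin 8 ⊕ Fin 3) (Fin 8 ⊕ Fin 3) ℚ :=
  PQ + CQᵀ * Matrix.diagonal (fun e => lamQ e * aQ) * CQ

/-! ### Kernel decisions -/

set_option maxHeartbeats 4000000 in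
/-- **The eight rank-one facts against the lower matrix**: `s_e·L − C_eᵀC_e ⪰ 0` (11 × 11 `LDLᵀ` each,
decided in the kernel). -/
theorem rk_ldl : ∀ e : Fin 8, PSD.LDLCert ((sLQ e • LQ - Matrix.vecMulVec (CQ e) (CQ e)).submatrix
    e1.symm e1.symm) := by
  decide +kernel

/-- The level tests: `s_e > 0` and `cLQ·s_e ≤ γ_lo²` (`γ_lo = 97/200`) on every line. -/
theorem level_tests : (∀ e : Fin 8, 0 < sLQ e) ∧ ∀ e : Fin 8, cLQ * sLQ e ≤ (97 / 200 : ℚ) ^ 2 := by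
  constructor <;> decide +kernel

/-- The ball tests: `0 ≤ p₂`, `p₂·ϱ ≤ cLQ` (equality in fact) and `(C_eᵀC_e)·ϱ < γ_lo²` on every line
(`C_eᵀC_e ∈ {1, 2}`). -/
theorem ball_tests : 0 ≤ p2Q ∧ p2Q * rhoLQ ≤ cLQ ∧
    ∀ e : Fin 8, (CQ e ⬝ᵥ CQ e) * rhoLQ < (97 / 200 : ℚ) ^ 2 := by
  refine ⟨by norm_num [p2Q], by norm_num [p2Q, rhoLQ, cLQ], ?_⟩
  decide +kernel

/-- The level ratio of record: `cLQ / cQ = 8085·655360000 / (65536·366951)` and it exceeds `220`. -/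
theorem level_ratio : (220 : ℚ) < cLQ / cQ := by norm_num [cLQ, cQ]

/-! ### Cast plumbing -/

/-- `(M·N) ↦ ℝ` (plumbing). -/
private theorem map_mul' {m n o : Type*} [Fintype n] (M : Matrix m n ℚ) (N : Matrix n o ℚ) :
    (M * N).map (Rat.cast : ℚ → ℝ) = M.map (Rat.cast : ℚ → ℝ) * N.map (Rat.cast : ℚ → ℝ) :=
  Matrix.map_mul (f := Rat.castHom ℝ)
/-- `(M+N) ↦ ℝ` (plumbing). -/
private theorem map_add' {m n : Type*} (M N : Matrix m n ℚ) :
    (M + N).map (Rat.cast : ℚ → ℝ) = M.map (Rat.cast : ℚ → ℝ) + N.map (Rat.cast : ℚ → ℝ) := by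
  ext i j; simp
/-- `(M−N) ↦ ℝ` (plumbing). -/
private theorem map_sub' {m n : Type*} (M N : Matrix m n ℚ) :
    (M - N).map (Rat.cast : ℚ → ℝ) = M.map (Rat.cast : ℚ → ℝ) - N.map (Rat.cast : ℚ → ℝ) := by
  ext i j; simp
/-- transpose commutes with the cast (plumbing). -/
private theorem map_transpose' {m n : Type*} (M : Matrix m n ℚ) :
    Mᵀ.map (Rat.cast : ℚ → ℝ) = (M.map (Rat.cast : ℚ → ℝ))ᵀ := rfl
/-- `diag(d) ↦ ℝ` (plumbing). -/
private theorem map_diagonal' {n : Type*} [DecidableEq n] (d : n → ℚ) :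
    (Matrix.diagonal d).map (Rat.cast : ℚ → ℝ) = Matrix.diagonal (fun i => (d i : ℝ)) :=
  Matrix.diagonal_map Rat.cast_zero
/-- `(q • M) ↦ ℝ` (plumbing). -/
private theorem map_smul' {m n : Type*} (q : ℚ) (M : Matrix m n ℚ) :
    (q • M).map (Rat.cast : ℚ → ℝ) = (q : ℝ) • M.map (Rat.cast : ℚ → ℝ) := by
  ext i j; simp
/-- `vecMulVec` commutes with the cast (plumbing). -/
private theorem map_vecMulVec' {m n : Type*} (u : m → ℚ) (v : n → ℚ) :
    (Matrix.vecMulVec u v).map (Rat.cast : ℚ → ℝ)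
      = Matrix.vecMulVec (fun i => (u i : ℝ)) (fun j => (v j : ℝ)) := by
  ext i j; simp [Matrix.vecMulVec]

/-- **The certificate's LOWER comparison matrix IS `LQ ↦ ℝ`** (`cert.toLP.lowerMatrix =
P + Cᵀ·diag(λa)·C` by `SlabCertificate.toLP_lowerMatrix`, then casts). -/
theorem lowerMatrix_eq : cert.toLP.lowerMatrix = LQ.map (Rat.cast : ℚ → ℝ) := by
  have hd : Matrix.diagonal (fun k => cert.lam k * cert.a k)
      = (Matrix.diagonal (fun e => lamQ e * aQ)).map (Rat.cast : ℚ → ℝ) := by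
    rw [map_diagonal']
    congr 1; funext k
    show (lamQ k : ℝ) * (aQ : ℝ) = ((lamQ k * aQ : ℚ) : ℝ)
    push_cast; ring
  rw [SlabCertificate.toLP_lowerMatrix, hd, C_eq]
  show P + _ = _
  rw [P, LQ]
  simp only [map_add', map_mul', map_transpose']

/-- A channel row of `C` over `ℝ` is the cast of the `ℚ` row. -/
theorem C_row_eq (e : Fin 8) : (WSCC9SP.relLurie D).C e = fun i => ((CQ e i : ℚ) : ℝ) := by
  funext i
  rw [C_eq]
  rfl

/-- **The eight rank-one facts over `ℝ` against the certificate's lower matrix.** -/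
theorem lower_rankOne (e : Fin 8) :
    (((sLQ e : ℚ) : ℝ) • cert.toLP.lowerMatrix
      - Matrix.vecMulVec ((WSCC9SP.relLurie D).C e) ((WSCC9SP.relLurie D).C e)).PosSemidef := by
  have hq : ((sLQ e : ℚ) : ℝ) • cert.toLP.lowerMatrix
      - Matrix.vecMulVec ((WSCC9SP.relLurie D).C e) ((WSCC9SP.relLurie D).C e)
      = (sLQ e • LQ - Matrix.vecMulVec (CQ e) (CQ e)).map (Rat.cast : ℚ → ℝ) := by
    rw [lowerMatrix_eq, C_row_eq, map_sub', map_smul', map_vecMulVec']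
  rw [hq]
  have h := ((rk_ldl e).posSemidef (R := ℝ)).submatrix e1
  have e2 : (((sLQ e • LQ - Matrix.vecMulVec (CQ e) (CQ e)).submatrix ⇑e1.symm ⇑e1.symm).map
      (Rat.cast : ℚ → ℝ)).submatrix e1 e1
      = (sLQ e • LQ - Matrix.vecMulVec (CQ e) (CQ e)).map (Rat.cast : ℚ → ℝ) := by
    ext i j; simp
  rwa [e2] at h

/-! ### The face hypothesis at the enlarged level, and ★ #45's sentence at that level -/

/-- `γ_lo = 97/200 < 2·arctan(1/4)` (the declared window), as in ★ #45. -/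
theorem gammaLo_lt : (((97 / 200 : ℚ)) : ℝ) < 2 * Real.arctan (((1 / 4 : ℚ)) : ℝ) := by
  have hu0 : (0 : ℝ) < ((1 / 4 : ℚ) : ℝ) := by norm_num
  have hγ0 : (0 : ℝ) ≤ ((97 / 200 : ℚ) : ℝ) := by norm_num
  have hγ : (((97 / 200 : ℚ)) : ℝ) ^ 2 * (1 + (((1 / 4 : ℚ)) : ℝ) ^ 2) ≤ 4 * (((1 / 4 : ℚ)) : ℝ) ^ 2 := by
    norm_num
  exact lt_two_arctan_of_sq_le hu0 hγ0 hγ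

/-- **The face hypothesis `hfr` at level `cLQ`**: `cLQ < V` on the frontier of the slab
`|σ_e − σ*_e| < 2·arctan(1/4)` — lit-6's `LPSlabCertificate.lt_V_of_mem_frontier_slab` applied to
`cert.toLP` with the lower rank-one facts and the closed tests `cLQ·s_e ≤ γ_lo²`. -/
theorem hfrLP : ∀ x ∈ frontier ((WSCC9SP.relLurie D).slab (fun _ : Fin 8 => 2 * Real.arctan ((1 / 4 : ℚ) : ℝ))),
    ((cLQ : ℚ) : ℝ) < cert.V x := by
  intro x hx
  have hγ0 : (0 : ℝ) ≤ ((97 / 200 : ℚ) : ℝ) := by norm_num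
  have hs0 : ∀ e : Fin 8, (0 : ℝ) < ((sLQ e : ℚ) : ℝ) := fun e => by exact_mod_cast level_tests.1 e
  have hc : ∀ e : Fin 8, ((cLQ : ℚ) : ℝ) * ((sLQ e : ℚ) : ℝ) ≤ (((97 / 200 : ℚ)) : ℝ) ^ 2 := fun e => by
    exact_mod_cast level_tests.2 e
  have hc' : ∀ e : Fin 8, ((cLQ : ℚ) : ℝ) < (2 * Real.arctan (((1 / 4 : ℚ)) : ℝ)) ^ 2 / ((sLQ e : ℚ) : ℝ) :=
    Params.level_lt_of_rankOne_test hγ0 gammaLo_lt hs0 hc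
  have h := cert.toLP.lt_V_of_mem_frontier_slab (γ := fun _ : Fin 8 => 2 * Real.arctan ((1 / 4 : ℚ) : ℝ))
    hsec hs0 lower_rankOne hc' hx
  rwa [SlabCertificate.toLP_V] at h

/-- **«#45-LEVEL+ (LP)» — ★ #45's certified region at the ENLARGED level `cLQ = 8085/65536`.** For every
phase point `y = (δ, ω)` of MODEL M′_D = `(WSCC9SP.params D).phaseField` whose 8 listed line-angle
deviations satisfy `|σ_e − σ*_e| ≤ 97/200` and whose relative state has `V(relState y) ≤ cLQ`
(`V = xᵀPx + 2Σ λ_e∫F_e`, ★ #45's slab Lyapunov function, SAME certificate): a solution from `y` exists and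
EVERY solution keeps `|σ_e(t) − σ*_e| < 2·atan(1/4)` and `V ≤ cLQ` for all `t ≥ 0`, every bus-angle
difference `δ_v − δ_w → δ*_v − δ*_w`, and every machine frequency deviation `ω_v → 0`. CERTIFIED for MODEL
M′_D, CLASS = slab `u = 1/4`, `γ_lo = 97/200`, level `cLQ` (220.3× ★ #45's `cQ`); MODELLED as ★ #45 verbatim
(canary, NOT of record); inner estimate. Nothing here says the WSCC system is stable.
[cite: Khalil2002, §7.1.2 Theorem 7.3 with §7.1 Example 7.5; Pai1981, §2.16 Theorem [18] and §4.6 eqs. (4.45)–(4.46); VuTuritsyn2017, §4.3 Theorem 1] -/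
theorem sp9_slab_roa_levelLP {y : (Fin 9 → ℝ) × (Fin 9 → ℝ)}
    (hy : ∀ e, |(y.1 (srcV e) - y.1 (tgtV e)) - (δ₀ (srcV e) - δ₀ (tgtV e))| ≤ ((97 / 200 : ℚ) : ℝ))
    (hyc : cert.V (relState ref gnode δ₀ y) ≤ ((cLQ : ℚ) : ℝ)) :
    (∃ X : ℝ → (Fin 9 → ℝ) × (Fin 9 → ℝ), X 0 = y ∧
        ∀ T : ℝ, ∀ t ∈ Icc 0 T, HasDerivWithinAt X ((WSCC9SP.params D).phaseField (X t)) (Icc 0 T) t) ∧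
      ∀ X : ℝ → (Fin 9 → ℝ) × (Fin 9 → ℝ), X 0 = y →
        (∀ T : ℝ, ∀ t ∈ Icc 0 T, HasDerivWithinAt X ((WSCC9SP.params D).phaseField (X t)) (Icc 0 T) t) →
        (∀ t, 0 ≤ t →
            (∀ e, |((X t).1 (srcV e) - (X t).1 (tgtV e)) - (δ₀ (srcV e) - δ₀ (tgtV e))|
              < 2 * Real.arctan ((1 / 4 : ℚ) : ℝ)) ∧
            cert.V (relState ref gnode δ₀ (X t)) ≤ ((cLQ : ℚ) : ℝ)) ∧
          (∀ v w, Tendsto (fun t => (X t).1 v - (X t).1 w) atTop (𝓝 (δ₀ v - δ₀ w))) ∧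
          ∀ v ∈ genS, Tendsto (fun t => (X t).2 v) atTop (𝓝 0) := by
  refine ⟨(WSCC9SP.params D).exists_phaseSolution_Icc y, fun X hX0 hX => ?_⟩
  subst hX0
  have h0' : ∀ e, |((X 0).1 (srcV e) - (X 0).1 (tgtV e)) - (δ₀ (srcV e) - δ₀ (tgtV e))|
      < (fun _ : Fin 8 => 2 * Real.arctan ((1 / 4 : ℚ) : ℝ)) e := fun e => (hy e).trans_lt gammaLo_lt
  obtain ⟨hstay, hlim⟩ := Params.tendsto_relState_of_slabCertificate (wellFormed hD) ref_gnode.1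
    ref_gnode.2 mem_genS_iff (params_b_eq D) (pe_δ₀_eq_P0 D) cert hsec hfrLP hX h0' hyc
  exact ⟨hstay, Params.tendsto_of_tendsto_relState (p := WSCC9SP.params D) mem_genS_iff hlim⟩

/-! ### The certified inner ball of the enlarged well -/

/-- **`p₂·1 − upperMatrix ⪰ 0` for `cert.toLP`** (#94's `upper_posSemidef`; the two upper matrices are
the same matrix). -/
theorem upper_posSemidef_LP :
    (((p2Q : ℚ) : ℝ) • (1 : Matrix (Fin 8 ⊕ Fin 3) (Fin 8 ⊕ Fin 3) ℝ) - cert.toLP.upperMatrix).PosSemidef :=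
  upper_posSemidef

/-- The sector hypothesis on the NARROWER window `γ_lo = 97/200` (monotone in the window). -/
theorem hsec_lo : ∀ e ξ, |ξ - (WSCC9SP.relLurie D).δs e| ≤ (fun _ : Fin 8 => (((97 / 200 : ℚ)) : ℝ)) e →
    cert.a e ≤ Real.cos ξ ∧ Real.cos ξ ≤ cert.b e :=
  fun e ξ hξ => hsec e ξ (hξ.trans gammaLo_lt.le)

/-- The channel norms are the casts: `C_e ⬝ C_e = (CQ_e ⬝ CQ_e) ↦ ℝ`. -/
theorem channel_norm_eq (e : Fin 8) :
    (WSCC9SP.relLurie D).C e ⬝ᵥ (WSCC9SP.relLurie D).C e = (((CQ e ⬝ᵥ CQ e : ℚ)) : ℝ) := by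
  rw [C_row_eq]
  simp [dotProduct, Rat.cast_sum, Rat.cast_mul]

/-- **THE CERTIFIED INNER BALL of the enlarged well**: `{x : xᵀx ≤ ϱ}`, `ϱ = 8085/262336` (`√ϱ ≈ 0.1756`),
lies inside `{x ∈ slab(97/200) : V x ≤ cLQ}` — lit-6's `LPSlabCertificate.ball_subset_well` with #94's
`p₂`, the narrow-window sector facts and the decided `ball_tests`. (The «#45-BALL» radius² at the ε-level
is `cQ/p₂ ≈ 1.40·10⁻⁴`; here `ϱ ≈ 3.08·10⁻²`.) [cite: Khalil2002, Theorem 4.10 (hypothesis (4.25)) and §7.1.2 Theorem 7.3; VuTuritsyn2017, §4.3 Theorem 1 (set ℛ)] -/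
theorem ball_subset_well_LP :
    {x : Fin 8 ⊕ Fin 3 → ℝ | x ⬝ᵥ x ≤ ((rhoLQ : ℚ) : ℝ)} ⊆
      cert.toLP.well (fun _ : Fin 8 => (((97 / 200 : ℚ)) : ℝ)) ((cLQ : ℚ) : ℝ) := by
  obtain ⟨ht0, htc, hCk⟩ := ball_tests
  refine cert.toLP.ball_subset_well (γ := fun _ : Fin 8 => (((97 / 200 : ℚ)) : ℝ)) (fun _ => by norm_num)
    (by exact_mod_cast ht0) upper_posSemidef_LP hsec_lo (by exact_mod_cast htc) fun e => ?_
  rw [channel_norm_eq]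
  exact_mod_cast hCk e

/-- **THE SENTENCE FOR THE BALL**: from every phase point `y` of M′_D whose relative state
`x = relState y` (11 deviations: 8 bus angles relative to bus 9, 3 machine frequencies) satisfies
`xᵀx ≤ ϱ = 8085/262336` (`√ϱ ≈ 0.1756`), ALL conclusions of `sp9_slab_roa_levelLP` hold (window `≤ 97/200`
and level `V ≤ cLQ` discharged by `ball_subset_well_LP`). CERTIFIED for M′_D; a Euclidean inner ball of an
inner estimate. No sentence here says a grid is stable.
[cite: Khalil2002, Theorem 4.10 and §7.1.2 Theorem 7.3; Pai1981, §2.16 Theorem [18]; VuTuritsyn2017, §4.3 Theorem 1] -/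
theorem sp9_slab_roa_of_ball_LP {y : (Fin 9 → ℝ) × (Fin 9 → ℝ)}
    (hball : relState ref gnode δ₀ y ⬝ᵥ relState ref gnode δ₀ y ≤ ((rhoLQ : ℚ) : ℝ)) :
    (∃ X : ℝ → (Fin 9 → ℝ) × (Fin 9 → ℝ), X 0 = y ∧
        ∀ T : ℝ, ∀ t ∈ Icc 0 T, HasDerivWithinAt X ((WSCC9SP.params D).phaseField (X t)) (Icc 0 T) t) ∧
      ∀ X : ℝ → (Fin 9 → ℝ) × (Fin 9 → ℝ), X 0 = y →
        (∀ T : ℝ, ∀ t ∈ Icc 0 T, HasDerivWithinAt X ((WSCC9SP.params D).phaseField (X t)) (Icc 0 T) t) →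
        (∀ t, 0 ≤ t →
            (∀ e, |((X t).1 (srcV e) - (X t).1 (tgtV e)) - (δ₀ (srcV e) - δ₀ (tgtV e))|
              < 2 * Real.arctan ((1 / 4 : ℚ) : ℝ)) ∧
            cert.V (relState ref gnode δ₀ (X t)) ≤ ((cLQ : ℚ) : ℝ)) ∧
          (∀ v w, Tendsto (fun t => (X t).1 v - (X t).1 w) atTop (𝓝 (δ₀ v - δ₀ w))) ∧
          ∀ v ∈ genS, Tendsto (fun t => (X t).2 v) atTop (𝓝 0) := by
  have hw := ball_subset_well_LP hball
  rw [LPSlabCertificate.mem_well_iff] at hw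
  obtain ⟨hslab, hV⟩ := hw
  have hy : ∀ e, |(y.1 (srcV e) - y.1 (tgtV e)) - (δ₀ (srcV e) - δ₀ (tgtV e))| ≤ ((97 / 200 : ℚ) : ℝ) :=
    fun e => ((Params.mem_slab_relState_iff (WSCC9SP.params D) ref gnode srcV tgtV wt δ₀ _ y).1
      hslab e).le
  have hyc : cert.V (relState ref gnode δ₀ y) ≤ ((cLQ : ℚ) : ℝ) := by
    rwa [SlabCertificate.toLP_V] at hV
  exact sp9_slab_roa_levelLP hy hyc

end Summit.Ventures.GridStability.Bench.WSCC9SP9SlabLP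

end
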